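import Summits.CriticalPhenomena.SAWScalingLimit.Theorems.SAWDefectDecoherenceObservableToSLERCarvedReductionSqueezeSuperDomainCuts
import Literature.Topology.PlaneTopology.OpenSetArcs
import Literature.Topology.PlaneTopology.Janiszewski
import HarnessLib

/-!
# Two legs in one corridor make a window cross-cut — preparations (piece (M1a) of stub 5a4″
# `stub_carvedReduction_squeezeSolid`, part 1 of 2)

Piece of stub 5a4″ `stub_carvedReduction_squeezeSolid`
(`TwoPieceAdmRestrictionLimit → MovingCarvingSqueezeP FatAnchoredClassZeroSolid`) of the line
`bridge-gate-renewal` (r10) of the crux `SAWDefectDecoherence.ObservableToSLER`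
(stmt-CriticalPhenomena-14005; twin T2b″ of stmt-CriticalPhenomena-10472).  The window cross-cuts of
the common super-domain `E` (`stub_carvedReduction_superDomainOfCrosscuts`, p133663) are produced
in the sequel file `…SqueezeLegs` from a corridor and an exit; this file holds the plane topology it
rests on:

* `mem_connectedComponentIn_diff`, `exists_isSimpleArc_diff` — **non-separation, corridor form**:
  a compact set with connected complement whose part outside an open connected bounded `U` is
  preconnected — a simple arc INSIDE `U` (empty part), or an END-CUT of `U` (one point) — does not
  separate `U`, and two points off it are joined by a simple arc of `U` off it (Janiszewski for
  the set and `closedBall 0 R ∖ U`; generalises the twin's `arcNonSeparating`, p129685);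
* `isSimpleArc_glue_five` — gluing `η[0, s] + P + M + Q + η[s', 1]` into one simple arc from
  `η 0` to `η 1` under the natural pairwise-intersection hypotheses;
* `mem_dock` — coordinates on the docks (the diameter: `im_eq_of_mem_diameter`, …SuperDomainCuts).

Sources: Ch. Pommerenke, Boundary Behaviour of Conformal Maps (1992) §1.1 (Janiszewski);
M. H. A. Newman, Elements of the topology of plane sets of points (1939), Ch. III §1, Ch. V §11.
-/

noncomputable section
open scoped Topology
open Filter Set Metric
open Literature.Probability.RandomPlanarGeometry
open Literature.Topology.PlaneTopology

namespace Summit.CriticalPhenomena.SAWScalingLimit.Theorems.ObservableToSLER.Squeeze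

/-! ### Non-separation: arcs inside a domain and end-cuts of a domain -/

/-- **Janiszewski, corridor form.**  Let `U` be open, connected and bounded, `A` compact with
connected complement (e.g. a simple arc) such that `A ∖ U` is preconnected (empty: an arc inside
`U`; one point: an end-cut of `U`).  Then `A` does not separate `U`: any two points of `U ∖ A` lie
in the same connected component of `U ∖ A`. -/
theorem mem_connectedComponentIn_diff {U A : Set ℂ} {x y : ℂ} (hUo : IsOpen U) (hUc : IsConnected U)
    (hUb : Bornology.IsBounded U) (hA : IsCompact A) (hAc : IsConnected Aᶜ)
    (hAU : IsPreconnected (A \ U)) (hx : x ∈ U \ A) (hy : y ∈ U \ A) :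
    y ∈ connectedComponentIn (U \ A) x := by
  obtain ⟨R, hR⟩ := (hUb.union hA.isBounded).subset_ball (0 : ℂ)
  set B : Set ℂ := closedBall (0 : ℂ) R ∩ Uᶜ with hB
  have hBc : IsCompact B := (isCompact_closedBall _ _).inter_right hUo.isClosed_compl
  have hAB : A ∩ B = A \ U := by
    ext z
    simp only [hB, mem_inter_iff, mem_closedBall, dist_zero_right, mem_compl_iff, Set.mem_sdiff]
    constructor
    · rintro ⟨hzA, -, hzU⟩; exact ⟨hzA, hzU⟩
    · rintro ⟨hzA, hzU⟩
      exact ⟨hzA, (mem_ball_zero_iff.1 (hR (Or.inr hzA))).le, hzU⟩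
  have hAB' : IsPreconnected (A ∩ B) := by rw [hAB]; exact hAU
  have hyA : y ∈ connectedComponentIn Aᶜ x :=
    hAc.isPreconnected.subset_connectedComponentIn hx.2 subset_rfl hy.2
  have hUBc : U ⊆ Bᶜ := fun z hz hzB ↦ hzB.2 hz
  have hyB : y ∈ connectedComponentIn Bᶜ x :=
    hUc.isPreconnected.subset_connectedComponentIn hx.1 hUBc hy.1
  have hJ := janiszewski hA hBc hAB' hyA hyB
  have hcompl : (A ∪ B)ᶜ ⊆ (U \ A) ∪ (closedBall (0 : ℂ) R)ᶜ := by
    intro z hz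
    simp only [mem_compl_iff, mem_union, not_or, hB, mem_inter_iff, not_and] at hz
    by_cases hzR : z ∈ closedBall (0 : ℂ) R
    · exact Or.inl ⟨not_not.1 (hz.2 hzR), hz.1⟩
    · exact Or.inr hzR
  have hdisj : Disjoint (U \ A) (closedBall (0 : ℂ) R)ᶜ :=
    Set.disjoint_left.2 fun z hz hzR ↦ hzR (ball_subset_closedBall (hR (Or.inl hz.1)))
  have hxAB : x ∈ (A ∪ B)ᶜ := fun h ↦ h.elim hx.2 (fun hxB ↦ hxB.2 hx.1)
  have hsub : connectedComponentIn (A ∪ B)ᶜ x ⊆ U \ A :=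
    isPreconnected_connectedComponentIn.subset_left_of_subset_union (hUo.sdiff hA.isClosed)
      isClosed_closedBall.isOpen_compl hdisj ((connectedComponentIn_subset _ _).trans hcompl)
      ⟨x, mem_connectedComponentIn hxAB, hx⟩
  exact isPreconnected_connectedComponentIn.subset_connectedComponentIn
    (mem_connectedComponentIn hxAB) hsub hJ

/-- **Registered sub-goal `stub_carvedReduction_endcutNonSeparating`** (crux item stmt-CriticalPhenomena-14005,
stub 5a4″ `stub_carvedReduction_squeezeSolid`, piece (M1a′) ARCS INSIDE AND END-CUTS OF A CORRIDOR DO NOT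
SEPARATE IT): registry form of `mem_connectedComponentIn_diff`. -/
theorem stub_carvedReduction_endcutNonSeparating :
    ∀ (U A : Set ℂ) (x y : ℂ), IsOpen U → IsConnected U → Bornology.IsBounded U → IsCompact A →
      IsConnected Aᶜ → IsPreconnected (A \ U) → x ∈ U \ A → y ∈ U \ A →
      y ∈ connectedComponentIn (U \ A) x :=
  fun _ _ _ _ hUo hUc hUb hA hAc hAU hx hy => mem_connectedComponentIn_diff hUo hUc hUb hA hAc hAU hx hy

/-- In an open connected bounded `U`, off a non-separating compact `A` as in
`mem_connectedComponentIn_diff`, two distinct points of `U ∖ A` are joined by a simple arc in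
`U ∖ A`. -/
theorem exists_isSimpleArc_diff {U A : Set ℂ} {x y : ℂ} (hUo : IsOpen U) (hUc : IsConnected U)
    (hUb : Bornology.IsBounded U) (hA : IsCompact A) (hAc : IsConnected Aᶜ)
    (hAU : IsPreconnected (A \ U)) (hx : x ∈ U \ A) (hy : y ∈ U \ A) (hxy : x ≠ y) :
    ∃ L ⊆ U \ A, IsSimpleArc L x y := by
  have hmem := mem_connectedComponentIn_diff hUo hUc hUb hA hAc hAU hx hy
  have hopen : IsOpen (connectedComponentIn (U \ A) x) :=
    (hUo.sdiff hA.isClosed).connectedComponentIn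
  obtain ⟨L, hL, hLarc⟩ := exists_isSimpleArc_of_isOpen hopen isPreconnected_connectedComponentIn
    (mem_connectedComponentIn hx) hmem hxy
  exact ⟨L, hL.trans (connectedComponentIn_subset _ _), hLarc⟩

/-! ### Gluing five arcs -/

/-- Sub-arcs of an injective parametrisation on disjoint parameter intervals are disjoint. -/
theorem image_Icc_disjoint {γ : ℝ → ℂ} (hinj : InjOn γ (Icc 0 1)) {a b c d : ℝ} (ha : 0 ≤ a)
    (hbc : b < c) (hd : d ≤ 1) : Disjoint (γ '' Icc a b) (γ '' Icc c d) := by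
  refine Set.disjoint_left.2 ?_
  rintro z ⟨u, hu, rfl⟩ ⟨v, hv, huv⟩
  have hu1 : u ≤ 1 := (hu.2.trans hbc.le).trans (hv.1.trans (hv.2.trans hd))
  have hv0 : 0 ≤ v := ha.trans ((hu.1.trans hu.2).trans (hbc.le.trans hv.1))
  have h := hinj ⟨hv0, hv.2.trans hd⟩ ⟨ha.trans hu.1, hu1⟩ huv
  subst h
  exact absurd (hu.2.trans_lt hbc) (not_lt.2 hv.1)

/-- A point of an injectively parametrised arc lies on the sub-arc over `[a, b]` iff its parameter
does. -/
theorem mem_image_Icc_iff {γ : ℝ → ℂ} (hinj : InjOn γ (Icc 0 1)) {a b t : ℝ} (ha : 0 ≤ a)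
    (hb : b ≤ 1) (ht : t ∈ Icc (0 : ℝ) 1) : γ t ∈ γ '' Icc a b ↔ t ∈ Icc a b := by
  constructor
  · rintro ⟨u, hu, hut⟩
    have h := hinj ⟨ha.trans hu.1, hu.2.trans hb⟩ ht hut
    subst h
    exact hu
  · exact fun h => ⟨t, h, rfl⟩

/-- **Gluing five arcs.**  For an injectively parametrised arc `γ[0, 1]`, parameters
`0 < s < s' < 1`, an arc `P` from `γ s` to `t₁` meeting `γ[0, 1]` only in `γ s`, an arc `M` from
`t₁` to `t₂` missing `γ[0, 1]`, an arc `Q` from `t₂` to `γ s'` meeting `γ[0, 1]` only in `γ s'`,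
with `P ∩ M ⊆ {t₁}`, `M ∩ Q ⊆ {t₂}`, `P ∩ Q = ∅`: the union `γ[0, s] ∪ P ∪ M ∪ Q ∪ γ[s', 1]` is
a simple arc from `γ 0` to `γ 1`. -/
theorem isSimpleArc_glue_five {γ : ℝ → ℂ} (hγ : Continuous γ) (hinj : InjOn γ (Icc 0 1))
    {s s' : ℝ} (hs : 0 < s) (hss' : s < s') (hs' : s' < 1) {P M Q : Set ℂ} {t₁ t₂ : ℂ}
    (hP : IsSimpleArc P (γ s) t₁) (hM : IsSimpleArc M t₁ t₂) (hQ : IsSimpleArc Q t₂ (γ s'))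
    (hPη : P ∩ γ '' Icc 0 1 ⊆ {γ s}) (hQη : Q ∩ γ '' Icc 0 1 ⊆ {γ s'})
    (hMη : Disjoint M (γ '' Icc 0 1)) (hPM : P ∩ M ⊆ {t₁}) (hMQ : M ∩ Q ⊆ {t₂})
    (hPQ : Disjoint P Q) :
    IsSimpleArc (γ '' Icc 0 s ∪ P ∪ M ∪ Q ∪ γ '' Icc s' 1) (γ 0) (γ 1) := by
  have hs1 : s ≤ 1 := hss'.le.trans hs'.le
  have hs'0 : 0 ≤ s' := hs.le.trans hss'.le
  have h1 : IsSimpleArc (γ '' Icc 0 s) (γ 0) (γ s) :=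
    isSimpleArc_image_Icc hγ.continuousOn hinj le_rfl hs hs1
  have h5 : IsSimpleArc (γ '' Icc s' 1) (γ s') (γ 1) :=
    isSimpleArc_image_Icc hγ.continuousOn hinj hs'0 hs' le_rfl
  have hsub1 : γ '' Icc 0 s ⊆ γ '' Icc 0 1 := image_mono (Icc_subset_Icc le_rfl hs1)
  have hsub5 : γ '' Icc s' 1 ⊆ γ '' Icc 0 1 := image_mono (Icc_subset_Icc hs'0 le_rfl)
  have hs'1 : γ s' ∉ γ '' Icc 0 s := fun h => by
    have := (mem_image_Icc_iff hinj le_rfl hs1 ⟨hs'0, hs'.le⟩).1 h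
    exact absurd this.2 (not_le.2 hss')
  have hs5 : γ s ∉ γ '' Icc s' 1 := fun h => by
    have := (mem_image_Icc_iff hinj hs'0 le_rfl ⟨hs.le, hs1⟩).1 h
    exact absurd this.1 (not_le.2 hss')
  have h2 : IsSimpleArc (γ '' Icc 0 s ∪ P) (γ 0) t₁ :=
    h1.union hP fun z hz => hPη ⟨hz.2, hsub1 hz.1⟩
  have h3 : IsSimpleArc (γ '' Icc 0 s ∪ P ∪ M) (γ 0) t₂ := by
    refine h2.union hM ?_
    rintro z ⟨hz | hz, hzM⟩
    · exact (Set.disjoint_left.1 hMη hzM (hsub1 hz)).elim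
    · exact hPM ⟨hz, hzM⟩
  have h4 : IsSimpleArc (γ '' Icc 0 s ∪ P ∪ M ∪ Q) (γ 0) (γ s') := by
    refine h3.union hQ ?_
    rintro z ⟨(hz | hz) | hz, hzQ⟩
    · have h := hQη ⟨hzQ, hsub1 hz⟩
      rw [mem_singleton_iff] at h
      subst h
      exact (hs'1 hz).elim
    · exact (Set.disjoint_left.1 hPQ hz hzQ).elim
    · exact hMQ ⟨hz, hzQ⟩
  refine h4.union h5 ?_
  rintro z ⟨((hz | hz) | hz) | hz, hz5⟩
  · exact (Set.disjoint_left.1 (image_Icc_disjoint hinj le_rfl hss' le_rfl) hz hz5).elim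
  · have h := hPη ⟨hz, hsub5 hz5⟩
    rw [mem_singleton_iff] at h
    subst h
    exact (hs5 hz5).elim
  · exact (Set.disjoint_left.1 hMη hz (hsub5 hz5)).elim
  · exact hQη ⟨hz, hsub5 hz5⟩

/-! ### Window geometry: the diameter and the docks -/

/-- Points of a dock (the vertical segment of length `ρ/2` hanging from `a`): same abscissa as
`a`, height at most that of `a`, and the only point at the height of `a` is `a`. -/
theorem mem_dock {a z : ℂ} {ρ : ℝ} (hρ : 0 < ρ)
    (hz : z ∈ segment ℝ a (a - ((ρ / 2 : ℝ) : ℂ) * Complex.I)) :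
    z.re = a.re ∧ z.im ≤ a.im ∧ (z.im = a.im → z = a) := by
  rw [segment_eq_image'] at hz
  obtain ⟨θ, hθ, rfl⟩ := hz
  have hre : (a + θ • (a - ((ρ / 2 : ℝ) : ℂ) * Complex.I - a)).re = a.re := by
    simp [Complex.ofReal_re, Complex.ofReal_im]
  have him : (a + θ • (a - ((ρ / 2 : ℝ) : ℂ) * Complex.I - a)).im = a.im - θ * (ρ / 2) := by
    simp [Complex.ofReal_re, Complex.ofReal_im]; ring
  refine ⟨hre, by rw [him]; nlinarith [hθ.1], fun h => ?_⟩
  rw [him] at h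
  have hθ0 : θ = 0 := by nlinarith [hθ.1]
  subst hθ0
  simp

end Summit.CriticalPhenomena.SAWScalingLimit.Theorems.ObservableToSLER.Squeeze

end
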